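import Summits.QuantumAdvantage.QuantumAdvantage.Theses.CommutingDeciders
import Literature.Computability.Complexity.PromiseZPPProofs
import HarnessLib
import HarnessLib.Audit

set_option linter.dupNamespace false -- D-0017: single-problem summit ⇒ `QuantumAdvantage.QuantumAdvantage` by design

/-!
# `CommutingDeciders.CommutingWitness` — the promise factorisation (split glue, crux-strategist)

Route `route-QuantumAdvantage-CommutingDeciders`, deciding crux `CommutingWitness` (item
stmt-QuantumAdvantage-2639: some language `L ∉ BPP` has a ONE-SHOT COMMUTING DECIDER over
`iqpDiag = {Z, CZ, T}`).  The crux is summit-strength (it implies `QuantumAdvantage` through the route's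
bridge `CommutingDecidersInBQP`); this file PROVES the assembly of its typed decomposition into two
load-bearing pieces (BC2 redirect, human ruling 2026-08-16), with the pieces INLINED as hypotheses (their
texts are the children statements filed on the route, decls `CommutingPromiseWitness` / `CommutingPromiseLift`):

* X₁ — COMMUTING PROMISE WITNESS: some PROMISE problem `Q ∉ PromiseBPP'` (textbook promise-BPP: the 2/3 gap is
  asked on the promise only, Goldreich 2006 Def. 1.2) has a one-shot commuting promise-decider (the inlined
  predicate of `CommutingWitness` with the gap asked on `Q.yes` / `Q.no` only);
* X₂ — COMMUTING PROMISE→LANGUAGE LIFT: if every LANGUAGE with a one-shot commuting decider is in `BPP`, then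
  every PROMISE problem with a one-shot commuting promise-decider is in `PromiseBPP'` — the IQP-level
  instance of the open lift `BQP ⊆ BPP → PromiseBQP ⊆ PromiseBPP'` (route PromiseLift; Goldreich 2011 §6;
  Aaronson–Arkhipov 2013 §10 (9)–(10)).

* `commutingWitness_of_promiseWitness_of_promiseLift` — X₁ → X₂ → `CommutingWitness` (contraposition);
* `promiseLift_of_commutingWitness`, `promiseWitness_of_commutingWitness` — the converses
  (`X → X₂` vacuously, `X → X₁` by `ofLanguage_mem_PromiseBPP'_iff`), so the factorisation is EXACT.

Logic only (the content is in the two pieces); no new definitions.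
-/

namespace Summit.QuantumAdvantage.QuantumAdvantage.Theorems

open scoped BigOperators Classical Matrix
open Literature.Computability.Cryptography Literature.Computability.Complexity
open Summit.QuantumAdvantage.QuantumAdvantage.Theses.CommutingDeciders

/-- **Split glue** (assembly of the promise factorisation of `CommutingWitness`): a commuting PROMISE
witness outside `PromiseBPP'` (X₁) and the commuting promise→language lift (X₂) give a commuting LANGUAGE
witness outside `BPP`.  Proof by contraposition: were `CommutingWitness` false, every language with a
one-shot commuting decider would be in `BPP`, so X₂ puts every commuting-decidable promise problem in
`PromiseBPP'`, contradicting X₁. [folklore] -/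
theorem commutingWitness_of_promiseWitness_of_promiseLift
    (h₁ : ∃ Q : PromiseProblem, Q ∉ PromiseBPP' ∧ ∃ (W : List Bool → ℕ) (D : (x : List Bool) → QCircuit iqpDiag (W x)) (A : Language Bool), A ∈ Classes.P ∧ PolyTimeComputable (id : List Bool → List Bool) (QCircuit.sigmaEncode (G := iqpDiag)) (fun x => (⟨W x, 0, D x⟩ : Σ n m : ℕ, QCircuit iqpDiag (n + m))) ∧ (∀ x ∈ Q.yes, (2 / 3 : ℝ) ≤ ∑ w : QReg (W x), (if boolPair x (List.ofFn w) ∈ A then ‖(iqpUnitary (D x) *ᵥ basisState (fun _ => false)) w‖ ^ 2 else 0)) ∧ (∀ x ∈ Q.no, ∑ w : QReg (W x), (if boolPair x (List.ofFn w) ∈ A then ‖(iqpUnitary (D x) *ᵥ basisState (fun _ => false)) w‖ ^ 2 else 0) ≤ (1 / 3 : ℝ)))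
    (h₂ : (∀ L : Language Bool, (∃ (W : List Bool → ℕ) (D : (x : List Bool) → QCircuit iqpDiag (W x)) (A : Language Bool), A ∈ Classes.P ∧ PolyTimeComputable (id : List Bool → List Bool) (QCircuit.sigmaEncode (G := iqpDiag)) (fun x => (⟨W x, 0, D x⟩ : Σ n m : ℕ, QCircuit iqpDiag (n + m))) ∧ ∀ x : List Bool, (x ∈ L → (2 / 3 : ℝ) ≤ ∑ w : QReg (W x), (if boolPair x (List.ofFn w) ∈ A then ‖(iqpUnitary (D x) *ᵥ basisState (fun _ => false)) w‖ ^ 2 else 0)) ∧ (x ∉ L → ∑ w : QReg (W x), (if boolPair x (List.ofFn w) ∈ A then ‖(iqpUnitary (D x) *ᵥ basisState (fun _ => false)) w‖ ^ 2 else 0) ≤ (1 / 3 : ℝ))) → L ∈ BPP) → ∀ Q : PromiseProblem, (∃ (W : List Bool → ℕ) (D : (x : List Bool) → QCircuit iqpDiag (W x)) (A : Language Bool), A ∈ Classes.P ∧ PolyTimeComputable (id : List Bool → List Bool) (QCircuit.sigmaEncode (G := iqpDiag)) (fun x => (⟨W x, 0, D x⟩ : Σ n m : ℕ, QCircuit iqpDiag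 (n + m))) ∧ (∀ x ∈ Q.yes, (2 / 3 : ℝ) ≤ ∑ w : QReg (W x), (if boolPair x (List.ofFn w) ∈ A then ‖(iqpUnitary (D x) *ᵥ basisState (fun _ => false)) w‖ ^ 2 else 0)) ∧ (∀ x ∈ Q.no, ∑ w : QReg (W x), (if boolPair x (List.ofFn w) ∈ A then ‖(iqpUnitary (D x) *ᵥ basisState (fun _ => false)) w‖ ^ 2 else 0) ≤ (1 / 3 : ℝ))) → Q ∈ PromiseBPP') :
    CommutingWitness := by
  by_contra hX
  obtain ⟨Q, hQ, hdec⟩ := h₁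
  refine hQ (h₂ ?_ Q hdec)
  intro L hL
  by_contra hBPP
  exact hX ⟨L, hBPP, hL⟩

/-- Converse 1: `CommutingWitness` gives the lift X₂ (vacuously — the witness falsifies the lift's
hypothesis). [folklore] -/
theorem promiseLift_of_commutingWitness (hX : CommutingWitness) :
    (∀ L : Language Bool, (∃ (W : List Bool → ℕ) (D : (x : List Bool) → QCircuit iqpDiag (W x)) (A : Language Bool), A ∈ Classes.P ∧ PolyTimeComputable (id : List Bool → List Bool) (QCircuit.sigmaEncode (G := iqpDiag)) (fun x => (⟨W x, 0, D x⟩ : Σ n m : ℕ, QCircuit iqpDiag (n + m))) ∧ ∀ x : List Bool, (x ∈ L → (2 / 3 : ℝ) ≤ ∑ w : QReg (W x), (if boolPair x (List.ofFn w) ∈ A then ‖(iqpUnitary (D x) *ᵥ basisState (fun _ => false)) w‖ ^ 2 else 0)) ∧ (x ∉ L → ∑ w : QReg (W x), (if boolPair x (List.ofFn w) ∈ A then ‖(iqpUnitary (D x) *ᵥ basisState (fun _ => false)) w‖ ^ 2 else 0) ≤ (1 / 3 : ℝ))) → L ∈ BPP) → ∀ Q : PromiseProblem, (∃ (W : List Bool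 → ℕ) (D : (x : List Bool) → QCircuit iqpDiag (W x)) (A : Language Bool), A ∈ Classes.P ∧ PolyTimeComputable (id : List Bool → List Bool) (QCircuit.sigmaEncode (G := iqpDiag)) (fun x => (⟨W x, 0, D x⟩ : Σ n m : ℕ, QCircuit iqpDiag (n + m))) ∧ (∀ x ∈ Q.yes, (2 / 3 : ℝ) ≤ ∑ w : QReg (W x), (if boolPair x (List.ofFn w) ∈ A then ‖(iqpUnitary (D x) *ᵥ basisState (fun _ => false)) w‖ ^ 2 else 0)) ∧ (∀ x ∈ Q.no, ∑ w : QReg (W x), (if boolPair x (List.ofFn w) ∈ A then ‖(iqpUnitary (D x) *ᵥ basisState (fun _ => false)) w‖ ^ 2 else 0) ≤ (1 / 3 : ℝ))) → Q ∈ PromiseBPP' := by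
  obtain ⟨L, hBPP, hdec⟩ := hX
  intro hall
  exact absurd (hall L hdec) hBPP

/-- Converse 2: `CommutingWitness` gives the promise witness X₁ (a language is the promise problem
`ofLanguage L`, and `ofLanguage L ∈ PromiseBPP' ↔ L ∈ BPP`). [folklore] -/
theorem promiseWitness_of_commutingWitness (hX : CommutingWitness) :
    ∃ Q : PromiseProblem, Q ∉ PromiseBPP' ∧ ∃ (W : List Bool → ℕ) (D : (x : List Bool) → QCircuit iqpDiag (W x)) (A : Language Bool), A ∈ Classes.P ∧ PolyTimeComputable (id : List Bool → List Bool) (QCircuit.sigmaEncode (G := iqpDiag)) (fun x => (⟨W x, 0, D x⟩ : Σ n m : ℕ, QCircuit iqpDiag (n + m))) ∧ (∀ x ∈ Q.yes, (2 / 3 : ℝ) ≤ ∑ w : QReg (W x), (if boolPair x (List.ofFn w) ∈ A then ‖(iqpUnitary (D x) *ᵥ basisState (fun _ => false)) w‖ ^ 2 else 0)) ∧ (∀ x ∈ Q.no, ∑ w : QReg (W x), (if boolPair x (List.ofFn w) ∈ A then ‖(iqpUnitary (D x) *ᵥ basisState (fun _ => false)) w‖ ^ 2 else 0) ≤ (1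 / 3 : ℝ)) := by
  obtain ⟨L, hBPP, W, D, A, hA, hU, hgap⟩ := hX
  refine ⟨PromiseProblem.ofLanguage L, ?_, W, D, A, hA, hU, ?_, ?_⟩
  · rwa [ofLanguage_mem_PromiseBPP'_iff]
  · intro x hx; exact (hgap x).1 hx
  · intro x hx; exact (hgap x).2 hx

end Summit.QuantumAdvantage.QuantumAdvantage.Theorems
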